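import Summits.AnomalousDissipation.AnomalousDissipation.Theses.WindLine
import Summits.AnomalousDissipation.AnomalousDissipation.Theorems.MirrorVarietySteadyWeakIsGlobalLerayHopf
import Literature.Analysis.FluidPDE.LongTimeAveragePeriodic

/-!
# Route WindLine — support `WindySteadyIsLerayHopf` (stmt-AnomalousDissipation-11422)

Folklore glue (Galdi 2000, Def. 2.1; Doering–Foias 2002, §2; Robinson–Rodrigo–Sadowski 2016,
Def. 4.9; Hopf 1951): a field `u ∈ L² ∩ H¹` on `T³`, weakly divergence free, solving the steady
tested Navier–Stokes equations against every smooth divergence-free field for a smooth force `f`,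
with the energy equation `ν ‖∇u‖² = (f, u)`, is — as the constant path `t ↦ u` — a global
Leray–Hopf solution from the datum `u`, with `meanEnergy = ∫ |u|²` and
`meanDissipation = ν ‖∇u‖²` (long-time means of constants).

This is the windy twin of route MirrorVariety's `SteadyWeakIsGlobalLerayHopf`
(stmt-AnomalousDissipation-2992): the Leray–Hopf bookkeeping for the constant path is exactly
`isLerayHopfOn_steady` of `Theorems/MirrorVarietySteadyWeakIsGlobalLerayHopf.lean` (which needs
neither `0 < ν` nor `∫ f = 0` — the tested identity is already assumed against ALL smooth
divergence-free fields here), and the means of the `1`-periodic constant path are its slice values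
(`meanEnergy_eq_of_periodic`, `meanDissipation_eq_of_periodic`).

Main result: `windySteadyIsLerayHopf_proof : WindySteadyIsLerayHopf` (the route decl, verbatim).
-/

-- `Summit.<Summit>.<Problem>` is the tree's mandated summit-side namespace (CONVENTIONS §2); for this
-- single-conjunct summit the two coincide, so the duplicate is deliberate.
set_option linter.dupNamespace false

noncomputable section

open MeasureTheory Filter Topology UnitAddTorus Set Function
open scoped InnerProductSpace RealInnerProductSpace ENNReal NNReal
open Literature.Analysis.FunctionSpaces Literature.Analysis.FunctionSpaces.Torus
open Literature.Analysis.FluidPDE Literature.Analysis.FluidPDE.Torus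

namespace Summit.AnomalousDissipation.AnomalousDissipation.Theorems

/-- **Route decl `WindySteadyIsLerayHopf` (stmt-AnomalousDissipation-11422), proved**: a steady
field `u ∈ L² ∩ H¹(T³)`, weakly divergence free, solving the tested steady Navier–Stokes equations
against every smooth divergence-free field for a smooth force `f`, with the energy equation
`ν ‖∇u‖² = ∫ ⟪f, u⟫`, is as the constant path a global Leray–Hopf solution from `u`
(`isLerayHopfOn_steady` on every `[0, T)`), with `meanEnergy = ∫ |u|²` and
`meanDissipation = ν ‖∇u‖²` (`meanEnergy_eq_of_periodic` / `meanDissipation_eq_of_periodic` with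
period `1`). The hypotheses `0 < ν` and `HasZeroMean f` of the route decl are not used. [folklore] -/
theorem windySteadyIsLerayHopf_proof :
    Summit.AnomalousDissipation.AnomalousDissipation.Theses.WindLine.WindySteadyIsLerayHopf := by
  intro ν f u _hν hf _hzf hu2 hH1 hdiv htest henergy
  refine ⟨fun T hT => isLerayHopfOn_steady hT hf hu2 hH1 hdiv htest henergy.symm, ?_, ?_⟩
  · -- mean energy of the constant (`1`-periodic) path
    rw [meanEnergy_eq_of_periodic (τ := 1) (fun _ => rfl) one_pos]
    simp
  · -- mean dissipation of the constant (`1`-periodic) path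
    rw [meanDissipation_eq_of_periodic (τ := 1) (fun _ => rfl) one_pos]
    simp

end Summit.AnomalousDissipation.AnomalousDissipation.Theorems

end
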